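import Summits.CriticalPhenomena.SAWScalingLimit.Theses.SAWDefectDecoherence
import Literature.Probability.RandomPlanarGeometry.HexSAWPathRigidity

/-!
# `BoundaryClosureR`, line `pick-half-plane`, stub `stub_identification`: two-root arc constancy
Sub-goal `identification_twoRootArcConstancy` of stub `stub_identification` (crux stmt-CriticalPhenomena-14004;
VERBATIM the sibling line's `TwoRootQuotient.TwoRootArcConstancy`): in a simply connected hexagonal
domain, for boundary roots `a, a'`, boundary targets `e, e'` (all distinct) and walks `γ₁ : a → e`,
`γ₂ : a' → e`, `γ₃ : a → e'`, `γ₄ : a' → e'`, `(W(γ₁) − W(γ₂)) − (W(γ₃) − W(γ₄)) ∈ {0, ±2π}` — the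
quotient `F_a/F_{a'}` has exactly two-valued phase on the whole (rough) boundary.
PROOF (exact; rigidity + one trivalent vertex, no Umlaufsatz formula).  Fix `e`; let `m` be the first
vertex of `γ₁` on `γ₂`.  By rigidity of windings between boundary mid-edges
(`HexMidEdgeSAW.winding_eq_of_mem_boundary`) replace `γ₁` by the splice `γ₁|_{a→m} · γ₂|_{m→e}`, and
note that `ζ := γ₁|_{a→m} · reverse(γ₂|_{a'→m})` is a walk `a → a'`.  In the coordinate model `HV`
(turns `±1` = `±π/3`) the codes are `A ++ m :: D`, `C ++ m :: D`, `A ++ m :: reverse C`; splitting the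
turn sums at `m`, the three turns at the trivalent `m` are `t, −t, −t` (`HV.turn_eq_neg_turn(')`), so
`pturn(A m D) − pturn(C m D) = pturn(A m C⁻¹) + 3t` (`pturn_merge`): `W(γ₁) − W(γ₂) = W(ζ) ± π`
(`winding_sub_winding_eq`).  Likewise `W(γ₃) − W(γ₄) = W(ζ') ± π`, and `W(ζ) = W(ζ')` by rigidity.
Helpers in tree vocabulary (no new definitions): `exists_walk`, `winding_eq_pturn_map_toHV`.
Reference: Duminil-Copin–Smirnov, Ann. of Math. 175 (2012), §2–3 (rigid boundary windings).
-/

noncomputable section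
open Literature.Probability.LatticeModels Literature.Probability.RandomPlanarGeometry.SAW
open Literature.Probability.RandomPlanarGeometry.SAW.HV
namespace Summit.CriticalPhenomena.SAWScalingLimit.Theorems.PickHalfPlane.Identification

/-! ### Turns at a trivalent vertex of the coordinate model -/

/-- A genuine turn of the honeycomb lattice is `±1` (in units of `π/3`). [folklore] -/
theorem turn_eq_one_or {v s p : HV} (hs : hvGraph.Adj v s) (hp : hvGraph.Adj v p) (hsp : s ≠ p) :
    turn s v p = 1 ∨ turn s v p = -1 := by
  rcases adj_cases hs hp with rfl | rfl | rfl
  · exact absurd rfl hsp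
  · exact Or.inr (turn_ccw hs)
  · exact Or.inl (turn_cw hs)

/-- **The merge identity.** For two lattice paths `A ++ m :: D`, `C ++ m :: D` merging at the
trivalent vertex `m` from the distinct neighbours `last A`, `last C` towards `head D`, the difference
of the turn sums is the turn sum of `A ++ m :: reverse C` plus `3 ×` the turn of the first at `m`.
[folklore] -/
theorem pturn_merge (A C D : List HV) (m : HV) (hA : A ≠ []) (hC : C ≠ []) (hD : D ≠ [])
    (ha : hvGraph.Adj m (A.getLast hA)) (hc : hvGraph.Adj m (C.getLast hC))
    (hd : hvGraph.Adj m (D.head hD)) (hac : A.getLast hA ≠ C.getLast hC)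
    (had : A.getLast hA ≠ D.head hD) (hcd : C.getLast hC ≠ D.head hD) :
    pturn (A ++ m :: D) - pturn (C ++ m :: D) =
      pturn (A ++ m :: C.reverse) + 3 * turn (A.getLast hA) m (D.head hD) := by
  have hCr : C.reverse ≠ [] := by simpa using hC
  have hCrh : C.reverse.head hCr = C.getLast hC := List.head_reverse hCr
  have e1 := pturn_append_cons_getLast A D hA m
  have e2 := pturn_append_cons_getLast C D hC m
  have e3 := pturn_append_cons_getLast A C.reverse hA m
  rw [pturn_cons_cons_append _ m D hD] at e1 e2
  rw [pturn_cons_cons_append _ m C.reverse hCr, hCrh] at e3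
  have e4 : pturn (m :: C.reverse) = -pturn (C ++ [m]) := by
    rw [← pturn_reverse, List.reverse_append, List.reverse_singleton, List.singleton_append]
  have t1 : turn (C.getLast hC) m (D.head hD) = -turn (A.getLast hA) m (D.head hD) :=
    turn_eq_neg_turn ha hd hc had hcd.symm hac
  have t2 : turn (A.getLast hA) m (C.getLast hC) = -turn (A.getLast hA) m (D.head hD) :=
    turn_eq_neg_turn' ha hd hc had hcd.symm hac
  rw [e1, e2, e3, e4, t1, t2]
  ring

/-! ### Walks from vertex lists, and their windings as turn counts -/

/-- **A walk from a vertex list**: a duplicate-free chain `L` of `Λ` from `w` to `w'`, entered from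
`u ∉ Λ` (`u ∼ w`) and left towards `e ∉ Λ`, `{u, w} ≠ {e, w'}`, is the vertex list of a self-avoiding
walk between the mid-edges `{u, w}` and `{e, w'}`. [folklore] -/
theorem exists_walk {Λ : Finset HexVertex} {u w e w' : HexVertex} (L : List HexVertex)
    (hh : L.head? = some w) (hl : L.getLast? = some w') (hsub : ∀ v ∈ L, v ∈ Λ) (hnd : L.Nodup)
    (hch : L.IsChain hexGraph.Adj) (hu : u ∉ Λ) (huw : hexGraph.Adj u w) (he : e ∉ Λ)
    (hne : s(u, w) ≠ s(e, w')) : ∃ γ : HexMidEdgeSAW Λ s(u, w) s(e, w'), γ.verts = L := by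
  have hL : L ≠ [] := by rintro rfl; simp at hh
  have hwL : w ∈ L := List.mem_of_head? hh
  refine ⟨⟨L, hsub, hnd, hch, fun v hv => ?_, fun v hv => ?_, fun h => absurd h hL, fun _ => ?_,
    ⟨(SimpleGraph.mem_edgeSet hexGraph).2 huw, w, Sym2.mem_mk_right _ _, hsub _ hwL⟩⟩, rfl⟩
  · rw [hh, Option.some_inj] at hv
    rw [← hv]; exact Sym2.mem_mk_right _ _
  · rw [hl, Option.some_inj] at hv
    rw [← hv]; exact Sym2.mem_mk_right _ _
  · refine List.nodup_append.2 ⟨List.nodup_cons.2 ⟨fun h => hu ?_, edges_nodup hnd⟩,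
      List.nodup_singleton _, fun x hx y hy => ?_⟩
    · exact hsub u (forall_mem_of_mem_edges L _ h u (Sym2.mem_mk_left _ _))
    · rw [List.mem_singleton] at hy
      subst hy
      rcases List.mem_cons.1 hx with rfl | hx
      · exact hne
      · rintro rfl
        exact he (hsub e (forall_mem_of_mem_edges L _ hx e (Sym2.mem_mk_left _ _)))

/-- **The winding of a walk between two boundary mid-edges as a turn count**: for `γ` from `{u, w}`
(`u ∉ Λ`, `u ∼ w`) to a different dangling edge `{u', w'}` (`u' ∉ Λ`, `u' ∼ w'`), `W(γ) = (π/3) · pturn`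
of the global code `toHV (u :: verts ++ [u'])` (the end half-edges do not turn, the embedded honeycomb
is the coordinate model scaled by `1/3`, lattice paths turn by `(π/3)·pturn`). [folklore] -/
theorem winding_eq_pturn_map_toHV {Λ : Finset HexVertex} {u w u' w' : HexVertex}
    (γ : HexMidEdgeSAW Λ s(u, w) s(u', w')) (hu : u ∉ Λ) (huw : hexGraph.Adj u w)
    (hu' : u' ∉ Λ) (huw' : hexGraph.Adj u' w') (hne : s(u, w) ≠ s(u', w')) :
    γ.winding = (Real.pi / 3) * pturn ((u :: (γ.verts ++ [u'])).map toHV) := by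
  have hL : γ.verts ≠ [] := fun h => hne (γ.eq_of_nil h)
  have hlast : γ.verts.getLast hL = w' := (γ.getLast_eq_or hL).resolve_left
    fun h => hu' (h ▸ γ.subset _ (List.getLast_mem hL))
  rw [γ.winding_eq_winding_map rfl hu hL (e := u') (Or.inr ⟨hlast, rfl⟩)]
  have e1 : (u :: (γ.verts ++ [u'])).map hexCenter =
      ((((u :: (γ.verts ++ [u'])).map toHV).map fun y => emb (pos y)).map
        fun z => (3 : ℂ)⁻¹ * z + 0) := by
    simp only [List.map_map]
    refine List.map_congr_left fun f _ => ?_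
    simp only [Function.comp_apply, emb_pos_toHV]
    ring
  rw [e1, winding_map_affine (inv_ne_zero three_ne_zero)]
  refine winding_map_emb_pos _ ?_ ?_
  · rw [List.isChain_map]
    refine List.IsChain.imp (fun x y h => (hexGraph_adj_iff_hvGraph_adj x y).1 h) ?_
    refine List.isChain_cons.2 ⟨fun y hy => ?_, List.isChain_append.2 ⟨γ.isChain,
      List.isChain_singleton _, fun x hx y hy => ?_⟩⟩
    · have h1 : (γ.verts ++ [u']).head? = some (γ.verts.head hL) := by
        rw [List.head?_eq_some_head (by simp [hL] : γ.verts ++ [u'] ≠ []),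
          List.head_append_of_ne_nil]
      rw [h1, Option.mem_def, Option.some_inj] at hy
      rw [← hy, γ.head_eq rfl hu hL]
      exact huw
    · rw [List.getLast?_eq_some_getLast hL, Option.mem_def, Option.some_inj] at hx
      simp only [List.head?_cons, Option.mem_def, Option.some_inj] at hy
      subst hx; subst hy
      rw [hlast]; exact huw'.symm
  · -- no backtracking: the tail `verts ++ [u']` has no repeated vertex, and `u` is not two steps on
    have hnd : ((γ.verts ++ [u']).map toHV).Nodup := by
      refine List.Nodup.map hvEquiv.injective (List.nodup_append.2
        ⟨γ.nodup, List.nodup_singleton _, fun x hx y hy => ?_⟩)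
      rw [List.mem_singleton] at hy
      subst hy
      rintro rfl
      exact hu' (γ.subset _ hx)
    intro i hi h
    rcases i with _ | i
    · simp only [List.map_cons, List.getElem_cons_zero, List.getElem_cons_succ] at h
      have hmem : ((γ.verts ++ [u']).map toHV)[1]'(by simp at hi ⊢; omega) ∈
          (γ.verts ++ [u']).map toHV := List.getElem_mem _
      rw [← h, List.mem_map] at hmem
      obtain ⟨y, hy, hyu⟩ := hmem
      have hyu' : y = u := hvEquiv.injective hyu
      rcases List.mem_append.1 hy with hy' | hy'
      · exact hu (hyu' ▸ γ.subset y hy')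
      · -- `u = u'` sits at index `1`: the walk visits one vertex, `w = w'`, so `{u,w} = {u',w'}`
        have hue : u = u' := hyu'.symm.trans (List.mem_singleton.1 hy')
        have hX : ((γ.verts ++ [u']).map toHV)[γ.verts.length]'(by simp) = toHV u' := by
          simp [List.getElem_append_right]
        have h2 : ((γ.verts ++ [u']).map toHV)[1]'(by simp at hi ⊢; omega) =
            ((γ.verts ++ [u']).map toHV)[γ.verts.length]'(by simp) := by
          rw [← h, hX]
          exact congrArg toHV hue
        have hlen : γ.verts.length = 1 := ((hnd.getElem_inj_iff).1 h2).symm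
        obtain ⟨x, r, hx⟩ := List.exists_cons_of_ne_nil hL
        have hr : r = [] := by simpa [hx] using hlen
        subst hr
        have hxw : x = w := by have := γ.head_eq rfl hu hL; simpa [hx] using this
        have hxw' : x = w' := by rw [← hlast]; simp [hx]
        exact hne (by rw [hue, ← hxw', hxw])
    · simp only [List.map_cons, List.getElem_cons_succ] at h
      have := (hnd.getElem_inj_iff).1 h
      omega

/-! ### One target, two roots -/

/-- A dangling edge `{u, w}` (`u ∼ w`, `u ∉ Λ ∋ w`) is a boundary mid-edge. [folklore] -/
theorem mk_mem_hexDomainBoundary' {Λ : Finset HexVertex} {u w : HexVertex} (hw : w ∈ Λ)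
    (hu : u ∉ Λ) (huw : hexGraph.Adj u w) : s(u, w) ∈ hexDomainBoundary Λ :=
  ⟨(SimpleGraph.mem_edgeSet hexGraph).2 huw, u, w, rfl, hw, hu⟩

/-- **Two roots, one target: the windings differ by a root-to-root winding `± π`.** For a simply
connected `Λ`, boundary roots `a ≠ a'`, a boundary target `e ≠ a, a'` and walks `γ₁ : a → e`,
`γ₂ : a' → e`, there are a walk `ζ : a → a'` and `t = ±1` with `W(γ₁) − W(γ₂) = W(ζ) + π t` (`ζ` = `γ₁`
up to its first vertex `m` on `γ₂`, then `γ₂` backwards; `t` = the turn of the merge at `m`). [folklore] -/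
theorem winding_sub_winding_eq {Λ : Finset HexVertex} (hΛ : hexDomainSimplyConnected Λ)
    {u₁ w₁ u₂ w₂ u₃ w₃ : HexVertex}
    (h₁ : hexGraph.Adj u₁ w₁) (hu₁ : u₁ ∉ Λ) (hw₁ : w₁ ∈ Λ)
    (h₂ : hexGraph.Adj u₂ w₂) (hu₂ : u₂ ∉ Λ) (h₃ : hexGraph.Adj u₃ w₃) (hu₃ : u₃ ∉ Λ)
    (hw₃ : w₃ ∈ Λ) (h12 : s(u₁, w₁) ≠ s(u₂, w₂)) (h13 : s(u₁, w₁) ≠ s(u₃, w₃))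
    (h23 : s(u₂, w₂) ≠ s(u₃, w₃))
    (γ₁ : HexMidEdgeSAW Λ s(u₁, w₁) s(u₃, w₃)) (γ₂ : HexMidEdgeSAW Λ s(u₂, w₂) s(u₃, w₃)) :
    ∃ (ζ : HexMidEdgeSAW Λ s(u₁, w₁) s(u₂, w₂)) (t : ℤ), (t = 1 ∨ t = -1) ∧
      γ₁.winding - γ₂.winding = ζ.winding + Real.pi * t := by
  classical
  have hne₁ : γ₁.verts ≠ [] := fun h => h13 (γ₁.eq_of_nil h)
  have hne₂ : γ₂.verts ≠ [] := fun h => h23 (γ₂.eq_of_nil h)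
  have hhead₁ : γ₁.verts.head hne₁ = w₁ := γ₁.head_eq rfl hu₁ hne₁
  have hhead₂ : γ₂.verts.head hne₂ = w₂ := γ₂.head_eq rfl hu₂ hne₂
  have hlast₁ : γ₁.verts.getLast hne₁ = w₃ := (γ₁.getLast_eq_or hne₁).resolve_left
    fun h => hu₃ (h ▸ γ₁.subset _ (List.getLast_mem hne₁))
  have hlast₂ : γ₂.verts.getLast hne₂ = w₃ := (γ₂.getLast_eq_or hne₂).resolve_left
    fun h => hu₃ (h ▸ γ₂.subset _ (List.getLast_mem hne₂))
  have hw₃₁ : w₃ ∈ γ₁.verts :=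
    List.mem_of_getLast? (by rw [List.getLast?_eq_some_getLast hne₁, hlast₁])
  have hw₃₂ : w₃ ∈ γ₂.verts :=
    List.mem_of_getLast? (by rw [List.getLast?_eq_some_getLast hne₂, hlast₂])
  obtain ⟨A, m, B, hsplit₁, hm₂, hA₂⟩ := exists_first_mem_split γ₁.verts γ₂.verts ⟨w₃, hw₃₁, hw₃₂⟩
  obtain ⟨C, D, hsplit₂⟩ := List.append_of_mem hm₂
  have hhead₁' : (A ++ m :: B).head? = some w₁ := by
    rw [← hsplit₁, List.head?_eq_some_head hne₁, hhead₁]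
  have hhead₂' : (C ++ m :: D).head? = some w₂ := by
    rw [← hsplit₂, List.head?_eq_some_head hne₂, hhead₂]
  have hlast₂' : (m :: D).getLast? = some w₃ := by
    rw [← List.getLast?_append_of_ne_nil C (List.cons_ne_nil m D), ← hsplit₂,
      List.getLast?_eq_some_getLast hne₂, hlast₂]
  have hsub₁ : ∀ x ∈ A ++ m :: B, x ∈ Λ := by rw [← hsplit₁]; exact γ₁.subset
  have hsub₂ : ∀ x ∈ C ++ m :: D, x ∈ Λ := by rw [← hsplit₂]; exact γ₂.subset
  have hnd₁ : (A ++ m :: B).Nodup := by rw [← hsplit₁]; exact γ₁.nodup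
  have hnd₂ : (C ++ m :: D).Nodup := by rw [← hsplit₂]; exact γ₂.nodup
  have hch₁ : (A ++ m :: B).IsChain hexGraph.Adj := by rw [← hsplit₁]; exact γ₁.isChain
  have hch₂ : (C ++ m :: D).IsChain hexGraph.Adj := by rw [← hsplit₂]; exact γ₂.isChain
  rw [hsplit₂] at hA₂
  have hAΛ : ∀ x ∈ A, x ∈ Λ := fun x hx => hsub₁ x (List.mem_append_left _ hx)
  have hmΛ : m ∈ Λ := hsub₁ m (by simp)
  have hCΛ : ∀ x ∈ C, x ∈ Λ := fun x hx => hsub₂ x (List.mem_append_left _ hx)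
  have hDΛ : ∀ x ∈ D, x ∈ Λ := fun x hx => hsub₂ x (by simp [hx])
  obtain ⟨hndA, hndmB, hdisj₁⟩ := List.nodup_append.1 hnd₁
  obtain ⟨hndC, hndmD, hdisj₂⟩ := List.nodup_append.1 hnd₂
  have hmC : m ∉ C := fun h => hdisj₂ m h m List.mem_cons_self rfl
  obtain ⟨hchA, hchmB, hjA⟩ := List.isChain_append.1 hch₁
  obtain ⟨hchC, hchmD, hjC⟩ := List.isChain_append.1 hch₂
  have hAm : ∀ x ∈ A.getLast?, hexGraph.Adj x m := fun x hx => hjA x hx m (by simp)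
  have hCm : ∀ x ∈ C.getLast?, hexGraph.Adj x m := fun x hx => hjC x hx m (by simp)
  have hmA : A = [] → m = w₁ := by rintro rfl; simpa using hhead₁'
  have hmC' : C = [] → m = w₂ := by rintro rfl; simpa using hhead₂'
  have hmD : D = [] → m = w₃ := by rintro rfl; simpa using hlast₂'
  have hhN : (A ++ m :: D).head? = some w₁ := by
    rw [← hhead₁']; cases A <;> simp
  have hlN : (A ++ m :: D).getLast? = some w₃ := by
    rw [List.getLast?_append_of_ne_nil A (List.cons_ne_nil m D), hlast₂']
  have hsubN : ∀ v ∈ A ++ m :: D, v ∈ Λ :=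
    List.forall_mem_append.2 ⟨hAΛ, List.forall_mem_cons.2 ⟨hmΛ, hDΛ⟩⟩
  have hndN : (A ++ m :: D).Nodup := List.nodup_append.2 ⟨hndA, hndmD, fun x hx y hy =>
    fun hxy => hA₂ x hx (hxy ▸ List.mem_append_right _ hy)⟩
  have hchN : (A ++ m :: D).IsChain hexGraph.Adj :=
    List.isChain_append.2 ⟨hchA, hchmD, fun x hx y hy => by
      simp only [List.head?_cons, Option.mem_def, Option.some_inj] at hy
      subst hy; exact hAm x hx⟩
  obtain ⟨γ₁', hγ₁'⟩ := exists_walk (A ++ m :: D) hhN hlN hsubN hndN hchN hu₁ h₁ hu₃ h13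
  have hhZ : (A ++ m :: C.reverse).head? = some w₁ := by
    rw [← hhead₁']; cases A <;> simp
  have hlZ : (A ++ m :: C.reverse).getLast? = some w₂ := by
    have e : m :: C.reverse = (C ++ [m]).reverse := by simp
    rw [List.getLast?_append_of_ne_nil A (List.cons_ne_nil m _), e, List.getLast?_reverse, ← hhead₂']
    cases C <;> simp
  have hsubZ : ∀ v ∈ A ++ m :: C.reverse, v ∈ Λ := List.forall_mem_append.2
    ⟨hAΛ, List.forall_mem_cons.2 ⟨hmΛ, fun v hv => hCΛ v (List.mem_reverse.1 hv)⟩⟩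
  have hndZ : (A ++ m :: C.reverse).Nodup :=
    List.nodup_append.2 ⟨hndA, List.nodup_cons.2 ⟨by simpa using hmC, List.nodup_reverse.2 hndC⟩,
      fun x hx y hy hxy => hA₂ x hx (by
        rcases List.mem_cons.1 hy with rfl | hy
        · rw [hxy]; simp
        · exact hxy ▸ List.mem_append_left _ (List.mem_reverse.1 hy))⟩
  have hchCm : (C ++ [m]).IsChain hexGraph.Adj :=
    List.isChain_append.2 ⟨hchC, List.isChain_singleton _, fun x hx y hy => by
      simp only [List.head?_cons, Option.mem_def, Option.some_inj] at hy
      subst hy; exact hCm x hx⟩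
  have hchZ : (A ++ m :: C.reverse).IsChain hexGraph.Adj := by
    refine List.isChain_append.2 ⟨hchA, ?_, fun x hx y hy => by
      simp only [List.head?_cons, Option.mem_def, Option.some_inj] at hy
      subst hy; exact hAm x hx⟩
    have e : m :: C.reverse = (C ++ [m]).reverse := by simp
    rw [e]
    exact List.isChain_reverse.2 (hchCm.imp fun _ _ h => h.symm)
  obtain ⟨ζ, hζ⟩ := exists_walk (A ++ m :: C.reverse) hhZ hlZ hsubZ hndZ hchZ hu₁ h₁ hu₂ h12
  have hW₁ : γ₁.winding = γ₁'.winding := HexMidEdgeSAW.winding_eq_of_mem_boundary hΛ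
    (mk_mem_hexDomainBoundary' hw₁ hu₁ h₁) (mk_mem_hexDomainBoundary' hw₃ hu₃ h₃) γ₁ γ₁'
  have hπ₁ := winding_eq_pturn_map_toHV γ₁' hu₁ h₁ hu₃ h₃ h13
  have hπ₂ := winding_eq_pturn_map_toHV γ₂ hu₂ h₂ hu₃ h₃ h23
  have hπζ := winding_eq_pturn_map_toHV ζ hu₁ h₁ hu₂ h₂ h12
  rw [hγ₁'] at hπ₁
  rw [hsplit₂] at hπ₂
  rw [hζ] at hπζ
  set Ah : List HV := (u₁ :: A).map toHV with hAh
  set Ch : List HV := (u₂ :: C).map toHV with hCh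
  set Dh : List HV := (D ++ [u₃]).map toHV with hDh
  have eX : (u₁ :: (A ++ m :: D ++ [u₃])).map toHV = Ah ++ toHV m :: Dh := by
    simp [hAh, hDh]
  have eY : (u₂ :: (C ++ m :: D ++ [u₃])).map toHV = Ch ++ toHV m :: Dh := by
    simp [hCh, hDh]
  have eZ : (u₁ :: (A ++ m :: C.reverse ++ [u₂])).map toHV = Ah ++ toHV m :: Ch.reverse := by
    simp [hAh, hCh, List.map_reverse]
  rw [eX] at hπ₁; rw [eY] at hπ₂; rw [eZ] at hπζ
  have hAh0 : Ah ≠ [] := by simp [hAh]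
  have hCh0 : Ch ≠ [] := by simp [hCh]
  have hDh0 : Dh ≠ [] := by simp [hDh]
  set a₀ : HexVertex := (u₁ :: A).getLast (List.cons_ne_nil _ _) with ha₀
  set c₀ : HexVertex := (u₂ :: C).getLast (List.cons_ne_nil _ _) with hc₀
  set b₀ : HexVertex := (D ++ [u₃]).head (by simp) with hb₀
  have hAl : Ah.getLast hAh0 = toHV a₀ := by simp only [hAh, List.getLast_map, ha₀]
  have hCl : Ch.getLast hCh0 = toHV c₀ := by simp only [hCh, List.getLast_map, hc₀]
  have hDl : Dh.head hDh0 = toHV b₀ := by simp only [hDh, List.head_map, hb₀]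
  have hadj_a : hexGraph.Adj m a₀ := by
    have hc : ((u₁ :: A) ++ m :: B).IsChain hexGraph.Adj := by
      rw [List.cons_append]
      refine List.isChain_cons.2 ⟨fun y hy => ?_, hch₁⟩
      rw [hhead₁', Option.mem_def, Option.some_inj] at hy
      rw [← hy]; exact h₁
    exact ((List.isChain_append.1 hc).2.2 a₀ (by rw [ha₀]; exact List.getLast?_eq_some_getLast _)
      m (by simp)).symm
  have hadj_c : hexGraph.Adj m c₀ := by
    have hc : ((u₂ :: C) ++ m :: D).IsChain hexGraph.Adj := by
      rw [List.cons_append]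
      refine List.isChain_cons.2 ⟨fun y hy => ?_, hch₂⟩
      rw [hhead₂', Option.mem_def, Option.some_inj] at hy
      rw [← hy]; exact h₂
    exact ((List.isChain_append.1 hc).2.2 c₀ (by rw [hc₀]; exact List.getLast?_eq_some_getLast _)
      m (by simp)).symm
  have hadj_b : hexGraph.Adj m b₀ := by
    have hc : (m :: (D ++ [u₃])).IsChain hexGraph.Adj := by
      rw [← List.cons_append]
      refine List.isChain_append.2 ⟨hchmD, List.isChain_singleton _, fun x hx y hy => ?_⟩
      simp only [List.head?_cons, Option.mem_def, Option.some_inj] at hy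
      subst hy
      rw [hlast₂', Option.mem_def, Option.some_inj] at hx
      rw [← hx]
      exact h₃.symm
    exact (List.isChain_cons.1 hc).1 b₀ (by rw [hb₀]; exact List.head?_eq_some_head _)
  have ha₀' : a₀ = u₁ ∧ A = [] ∨ a₀ ∈ A := by
    rcases A.eq_nil_or_concat' with hA | ⟨A', x, hA⟩
    · exact Or.inl ⟨by simp [ha₀, hA], hA⟩
    · exact Or.inr (by simp [ha₀, hA])
  have hc₀' : c₀ = u₂ ∧ C = [] ∨ c₀ ∈ C := by
    rcases C.eq_nil_or_concat' with hC | ⟨C', x, hC⟩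
    · exact Or.inl ⟨by simp [hc₀, hC], hC⟩
    · exact Or.inr (by simp [hc₀, hC])
  have hb₀' : b₀ = u₃ ∧ D = [] ∨ b₀ ∈ D := by
    rcases D with _ | ⟨d, D'⟩
    · exact Or.inl ⟨by simp [hb₀], rfl⟩
    · exact Or.inr (by simp [hb₀])
  have hac : a₀ ≠ c₀ := by
    rcases ha₀' with ⟨ha, hA⟩ | ha <;> rcases hc₀' with ⟨hc, hC⟩ | hc
    · rw [ha, hc]; intro h; apply h12; rw [h, ← hmA hA, ← hmC' hC]
    · rw [ha]; intro h; exact hu₁ (h ▸ hCΛ _ hc)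
    · rw [hc]; intro h; exact hu₂ (h ▸ hAΛ _ ha)
    · intro h; exact hA₂ _ ha (h ▸ List.mem_append_left _ hc)
  have hab : a₀ ≠ b₀ := by
    rcases ha₀' with ⟨ha, hA⟩ | ha <;> rcases hb₀' with ⟨hb, hD⟩ | hb
    · rw [ha, hb]; intro h; apply h13; rw [h, ← hmA hA, ← hmD hD]
    · rw [ha]; intro h; exact hu₁ (h ▸ hDΛ _ hb)
    · rw [hb]; intro h; exact hu₃ (h ▸ hAΛ _ ha)
    · intro h; exact hA₂ _ ha (h ▸ by simp [hb])
  have hcb : c₀ ≠ b₀ := by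
    rcases hc₀' with ⟨hc, hC⟩ | hc <;> rcases hb₀' with ⟨hb, hD⟩ | hb
    · rw [hc, hb]; intro h; apply h23; rw [h, ← hmC' hC, ← hmD hD]
    · rw [hc]; intro h; exact hu₂ (h ▸ hDΛ _ hb)
    · rw [hb]; intro h; exact hu₃ (h ▸ hCΛ _ hc)
    · intro h; exact hdisj₂ _ hc _ (List.mem_cons_of_mem _ hb) h
  have hinj : Function.Injective toHV := hvEquiv.injective
  have hadj_a' : hvGraph.Adj (toHV m) (Ah.getLast hAh0) :=
    hAl ▸ (hexGraph_adj_iff_hvGraph_adj _ _).1 hadj_a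
  have hadj_b' : hvGraph.Adj (toHV m) (Dh.head hDh0) :=
    hDl ▸ (hexGraph_adj_iff_hvGraph_adj _ _).1 hadj_b
  have hab' : Ah.getLast hAh0 ≠ Dh.head hDh0 := by rw [hAl, hDl]; exact fun h => hab (hinj h)
  have hmerge := pturn_merge Ah Ch Dh (toHV m) hAh0 hCh0 hDh0 hadj_a'
    (hCl ▸ (hexGraph_adj_iff_hvGraph_adj _ _).1 hadj_c) hadj_b'
    (by rw [hAl, hCl]; exact fun h => hac (hinj h)) hab'
    (by rw [hCl, hDl]; exact fun h => hcb (hinj h))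
  obtain ht := turn_eq_one_or hadj_a' hadj_b' hab'
  refine ⟨ζ, turn (Ah.getLast hAh0) (toHV m) (Dh.head hDh0), ht, ?_⟩
  have hm : (pturn (Ah ++ toHV m :: Dh) : ℝ) - pturn (Ch ++ toHV m :: Dh) =
      pturn (Ah ++ toHV m :: Ch.reverse) + 3 * turn (Ah.getLast hAh0) (toHV m) (Dh.head hDh0) := by
    exact_mod_cast hmerge
  rw [hW₁, hπ₁, hπ₂, hπζ]
  linear_combination (Real.pi / 3) * hm

/-! ### The registered sub-goal -/

/-- **Two-root arc constancy** (sub-goal `identification_twoRootArcConstancy` of stub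
`stub_identification`; VERBATIM `TwoRootQuotient.TwoRootArcConstancy`): for a simply connected `Λ`,
boundary roots `a, a'` and further boundary mid-edges `e, e'` (all distinct), `W_a(e) − W_{a'}(e)`
changes from `e` to `e'` by `0` or `±2π` only: `W(γ₁) − W(γ₂) = W(ζ) + πt`, `W(γ₃) − W(γ₄) = W(ζ') + πt'`
(`winding_sub_winding_eq`), `W(ζ) = W(ζ')` by rigidity, and `π(t − t') ∈ {0, ±2π}`. [folklore] -/
theorem identification_twoRootArcConstancy : ∀ (Λ : Finset HexVertex), hexDomainSimplyConnected Λ → ∀ (u₁ w₁ u₂ w₂ u₃ w₃ u₄ w₄ : HexVertex), hexGraph.Adj u₁ w₁ → u₁ ∉ Λ → w₁ ∈ Λ → hexGraph.Adj u₂ w₂ → u₂ ∉ Λ → w₂ ∈ Λ → hexGraph.Adj u₃ w₃ → u₃ ∉ Λ → w₃ ∈ Λ → hexGraph.Adj u₄ w₄ → u₄ ∉ Λ → w₄ ∈ Λ → List.Pairwise (· ≠ ·) [s(u₁, w₁), s(u₂, w₂), s(u₃, w₃), s(u₄, w₄)] → ∀ (γ₁ : HexMidEdgeSAW Λ s(u₁,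 w₁) s(u₃, w₃)) (γ₂ : HexMidEdgeSAW Λ s(u₂, w₂) s(u₃, w₃)) (γ₃ : HexMidEdgeSAW Λ s(u₁, w₁) s(u₄, w₄)) (γ₄ : HexMidEdgeSAW Λ s(u₂, w₂) s(u₄, w₄)), ∃ k : ℤ, (k = 0 ∨ k = 1 ∨ k = -1) ∧ (γ₁.winding - γ₂.winding) - (γ₃.winding - γ₄.winding) = 2 * Real.pi * k := by
  intro Λ hΛ u₁ w₁ u₂ w₂ u₃ w₃ u₄ w₄ h₁ hu₁ hw₁ h₂ hu₂ hw₂ h₃ hu₃ hw₃ h₄ hu₄ hw₄ hpw γ₁ γ₂ γ₃ γ₄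
  obtain ⟨hp1, hpw⟩ := List.pairwise_cons.1 hpw
  obtain ⟨hp2, -⟩ := List.pairwise_cons.1 hpw
  have h12 : s(u₁, w₁) ≠ s(u₂, w₂) := hp1 _ (by simp)
  have h13 : s(u₁, w₁) ≠ s(u₃, w₃) := hp1 _ (by simp)
  have h14 : s(u₁, w₁) ≠ s(u₄, w₄) := hp1 _ (by simp)
  have h23 : s(u₂, w₂) ≠ s(u₃, w₃) := hp2 _ (by simp)
  have h24 : s(u₂, w₂) ≠ s(u₄, w₄) := hp2 _ (by simp)
  obtain ⟨ζ, t, ht, hζ⟩ :=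
    winding_sub_winding_eq hΛ h₁ hu₁ hw₁ h₂ hu₂ h₃ hu₃ hw₃ h12 h13 h23 γ₁ γ₂
  obtain ⟨ζ', t', ht', hζ'⟩ :=
    winding_sub_winding_eq hΛ h₁ hu₁ hw₁ h₂ hu₂ h₄ hu₄ hw₄ h12 h14 h24 γ₃ γ₄
  have hrig : ζ.winding = ζ'.winding := HexMidEdgeSAW.winding_eq_of_mem_boundary hΛ
    (mk_mem_hexDomainBoundary' hw₁ hu₁ h₁) (mk_mem_hexDomainBoundary' hw₂ hu₂ h₂) ζ ζ'
  rw [hζ, hζ', hrig]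
  rcases ht with rfl | rfl <;> rcases ht' with rfl | rfl
  · exact ⟨0, Or.inl rfl, by push_cast; ring⟩
  · exact ⟨1, Or.inr (Or.inl rfl), by push_cast; ring⟩
  · exact ⟨-1, Or.inr (Or.inr rfl), by push_cast; ring⟩
  · exact ⟨0, Or.inl rfl, by push_cast; ring⟩

end Summit.CriticalPhenomena.SAWScalingLimit.Theorems.PickHalfPlane.Identification

end
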